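import Literature.Geometry.Riemannian.UnwindingRadialMonotone
import Literature.Geometry.Riemannian.UnwindingAngular
import Literature.Geometry.Riemannian.PolarGraphImmersion
import Literature.Geometry.Riemannian.PolarGraphCoLipschitz
import HarnessLib

/-!
# The shell package of the interior surgery map: injectivity and local co-Lipschitz bounds

Topic `Geometry/Riemannian`. Assembly of the estimates of `UnwindingCollarData.lean`,
`UnwindingRadialDerivative.lean`, `UnwindingRadialMonotone.lean` and `UnwindingAngular.lean` into
the hypotheses of the shell lemmas (`PolarGraphImmersion.injOn_polarGraph_local`,
`PolarGraphCoLipschitz.polarGraph_sub_le`) for the polar data of the interior surgery map of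
Weinstein's disk (Weinstein 1968, proof of the main theorem, step (3)):
`R(ρ, u) = ρ + χ(ρ)(‖C(cl ρ · N u)‖ - cl ρ)`, `Θ(ρ, u) = N(N u + χ(ρ)(N(C(cl ρ · N u)) - N u))`
(`χ(ρ) = smoothTransition (3ρ - 1)`, `cl = clamp_{ε₁}`, `N v = v/‖v‖`, `C` the collar cone map with
`C = id` and `⟪u, DC_u u⟫ ≥ 1` on the unit sphere).

* `unwinding_shell` — **there is `ε₁ > 0` such that `(ρ, u) ↦ R(ρ, u) Θ(ρ, u)` is injective on
  `(0, 1 + ε₁] × sphere` and locally co-Lipschitz** (quantitatively on every `[t, 1 + ε₁] × sphere`,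
  `t > 0`), with `R > 0`, `‖Θ‖ = 1`.

The functions `R`, `Θ` enter through defining hypotheses (`hR`, `hΘ`), so that no definitions are
introduced.

## References

* A. Weinstein, Ann. of Math. (2) 87 (1968), 29–41, proof of the main theorem, step (3).
  [cite: Weinstein1968]

Tags: [PolarGraph] [ConeMap] [Weinstein1968]
-/

noncomputable section

open Set Function Metric Filter Real
open scoped Topology RealInnerProductSpace

namespace Literature.Geometry.Riemannian

variable {V : Type*} [NormedAddCommGroup V] [InnerProductSpace ℝ V] [FiniteDimensional ℝ V]

set_option maxHeartbeats 1600000 in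
/-- **The shell package, with radial growth along fixed directions** (last conjunct:
`½(ρ' - ρ) ≤ R(ρ', u) - R(ρ, u)` for `ρ ≤ ρ'`). See the module docstring.
[cite: Weinstein1968, proof of the main theorem, step (3)] -/
theorem unwinding_shell₂ {C : V → V} {ε' : ℝ} (hε' : 0 < ε') (hε'1 : ε' ≤ 1 / 2)
    (hC : ContDiffOn ℝ 1 C {v : V | 1 - ε' < ‖v‖ ∧ ‖v‖ < 1 + ε'})
    (hC0 : ∀ v : V, 1 - ε' < ‖v‖ → ‖v‖ < 1 + ε' → C v ≠ 0)
    (hCid : ∀ u : V, ‖u‖ = 1 → C u = u) (hCtr : ∀ u : V, ‖u‖ = 1 → 1 ≤ ⟪u, fderiv ℝ C u u⟫) :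
    ∃ ε₁ : ℝ, 0 < ε₁ ∧ ε₁ ≤ ε' / 2 ∧ ε₁ ≤ 1 / 4 ∧
      ∀ (R : ℝ → V → ℝ) (Θ : ℝ → V → V),
        (∀ ρ u, R ρ u = ρ + smoothTransition (3 * ρ - 1) *
          (‖C (((1 - ε₁) + ε₁ / 2 * ((ρ - (1 - ε₁)) / (ε₁ / 2) *
              smoothTransition ((ρ - (1 - ε₁)) / (ε₁ / 2)))) • (‖u‖⁻¹ • u))‖ -
            ((1 - ε₁) + ε₁ / 2 * ((ρ - (1 - ε₁)) / (ε₁ / 2) *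
              smoothTransition ((ρ - (1 - ε₁)) / (ε₁ / 2)))))) →
        (∀ ρ u, Θ ρ u = ‖‖u‖⁻¹ • u + smoothTransition (3 * ρ - 1) •
            (‖C (((1 - ε₁) + ε₁ / 2 * ((ρ - (1 - ε₁)) / (ε₁ / 2) *
                smoothTransition ((ρ - (1 - ε₁)) / (ε₁ / 2)))) • (‖u‖⁻¹ • u))‖⁻¹ •
              C (((1 - ε₁) + ε₁ / 2 * ((ρ - (1 - ε₁)) / (ε₁ / 2) *
                smoothTransition ((ρ - (1 - ε₁)) / (ε₁ / 2)))) • (‖u‖⁻¹ • u)) - ‖u‖⁻¹ • u)‖⁻¹ •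
          (‖u‖⁻¹ • u + smoothTransition (3 * ρ - 1) •
            (‖C (((1 - ε₁) + ε₁ / 2 * ((ρ - (1 - ε₁)) / (ε₁ / 2) *
                smoothTransition ((ρ - (1 - ε₁)) / (ε₁ / 2)))) • (‖u‖⁻¹ • u))‖⁻¹ •
              C (((1 - ε₁) + ε₁ / 2 * ((ρ - (1 - ε₁)) / (ε₁ / 2) *
                smoothTransition ((ρ - (1 - ε₁)) / (ε₁ / 2)))) • (‖u‖⁻¹ • u)) - ‖u‖⁻¹ • u))) →
        InjOn (fun q : ℝ × V ↦ R q.1 q.2 • Θ q.1 q.2) (Ioc 0 (1 + ε₁) ×ˢ Metric.sphere (0 : V) 1) ∧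
        (∀ t : ℝ, 0 < t → ∃ K : ℝ, 0 ≤ K ∧ ∀ ρ ∈ Icc t (1 + ε₁), ∀ ρ' ∈ Icc t (1 + ε₁),
          ∀ u ∈ Metric.sphere (0 : V) 1, ∀ u' ∈ Metric.sphere (0 : V) 1, ‖u - u'‖ < 1 →
            |ρ' - ρ| + ‖u - u'‖ ≤ K * ‖R ρ' u' • Θ ρ' u' - R ρ u • Θ ρ u‖) ∧
        (∀ ρ ∈ Ioc (0 : ℝ) (1 + ε₁), ∀ u ∈ Metric.sphere (0 : V) 1, 0 < R ρ u ∧ ‖Θ ρ u‖ = 1) ∧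
        (∀ ρ ∈ Ioc (0 : ℝ) (1 + ε₁), ∀ ρ' ∈ Ioc (0 : ℝ) (1 + ε₁), ρ ≤ ρ' →
          ∀ u ∈ Metric.sphere (0 : V) 1, 1 / 2 * (ρ' - ρ) ≤ R ρ' u - R ρ u) := by
  have hε'1' : ε' < 1 := by linarith
  /- ── absolute constants ── -/
  obtain ⟨Cχ, hCχ0, hCχ⟩ := exists_bound_deriv_chi
  obtain ⟨Ch, hCh0, hCh⟩ := exists_bound_deriv_mul_smoothTransition
  -- the `σ`-Lipschitz constant of the angular drift on `[1 - ε'/2, 1 + ε'/2] × sphere`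
  have hw1 := contDiffOn_angularDrift (n := 1) hε'1' hC hC0
  obtain ⟨Lw, hLw0, hLw⟩ := exists_forall_sub_le_mul_abs_sub hε' hw1
  /- ── the smallness parameter `κ` ── -/
  set K₀ : ℝ := 1 + Cχ + Ch + Lw * Ch with hK₀
  have hK₀1 : 1 ≤ K₀ := by
    have : 0 ≤ Lw * Ch := mul_nonneg hLw0 hCh0
    rw [hK₀]; linarith
  set κ : ℝ := 1 / (64 * K₀) with hκdef
  have hκ : 0 < κ := by rw [hκdef]; positivity
  have hκ64 : κ ≤ 1 / 64 := by
    rw [hκdef, div_le_div_iff₀ (by positivity) (by norm_num)]; linarith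
  have hκK : κ * K₀ = 1 / 64 := by rw [hκdef]; field_simp
  have hκCC : κ * (Cχ + Ch) ≤ 1 / 4 := by
    have : κ * (Cχ + Ch) ≤ κ * K₀ := by
      apply mul_le_mul_of_nonneg_left _ hκ.le
      have : 0 ≤ Lw * Ch := mul_nonneg hLw0 hCh0
      rw [hK₀]; linarith
    linarith
  set A : ℝ := 4 * (Cχ * κ + Lw * Ch) with hAdef
  have hA0 : 0 ≤ A := by rw [hAdef]; positivity
  have hAB : A * κ < 1 / 2 * (1 / 2) := by
    -- `A κ = 4 Cχ κ² + 4 Lw Ch κ ≤ 4 (κ K₀) κ + 4 κ K₀ ≤ ...`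
    have h1 : Cχ * κ ≤ K₀ * κ := by
      apply mul_le_mul_of_nonneg_right _ hκ.le
      have : 0 ≤ Lw * Ch := mul_nonneg hLw0 hCh0
      rw [hK₀]; linarith
    have h2 : Lw * Ch ≤ K₀ := by rw [hK₀]; linarith
    have h3 : A * κ ≤ 4 * (K₀ * κ + K₀) * κ := by
      rw [hAdef]
      apply mul_le_mul_of_nonneg_right _ hκ.le
      linarith
    have h4 : 4 * (K₀ * κ + K₀) * κ = 4 * (κ * K₀) * κ + 4 * (κ * K₀) := by ring
    rw [h4, hκK] at h3
    linarith
  /- ── the collar estimates ── -/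
  obtain ⟨e₁, he₁, he₁ε, hest⟩ := exists_collar_estimates hε' hε'1' hC hC0 hCid hκ
  obtain ⟨e₂, he₂, he₂ε, hder⟩ := exists_forall_radialDeriv_ge hε' hε'1' hC hC0 hCid hCtr hκ
  set ε₁ : ℝ := min (min e₁ e₂) (min (ε' / 2) (1 / 4)) with hε₁def
  have hε₁ : 0 < ε₁ := by rw [hε₁def]; positivity
  have hε₁e₁ : ε₁ ≤ e₁ := (min_le_left _ _).trans (min_le_left _ _)
  have hε₁e₂ : ε₁ ≤ e₂ := (min_le_left _ _).trans (min_le_right _ _)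
  have hε₁ε : ε₁ ≤ ε' / 2 := (min_le_right _ _).trans (min_le_left _ _)
  have hε₁4 : ε₁ ≤ 1 / 4 := (min_le_right _ _).trans (min_le_right _ _)
  have hε₁ε' : ε₁ < ε' := by linarith
  refine ⟨ε₁, hε₁, hε₁ε, hε₁4, ?_⟩
  intro R Θ hR hΘ
  /- ── notation for the clamp, the defect and the drift ── -/
  set cl : ℝ → ℝ := fun ρ ↦ (1 - ε₁) + ε₁ / 2 * ((ρ - (1 - ε₁)) / (ε₁ / 2) *
    smoothTransition ((ρ - (1 - ε₁)) / (ε₁ / 2))) with hcl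
  set χ : ℝ → ℝ := fun ρ ↦ smoothTransition (3 * ρ - 1) with hχ
  set d : ℝ → V → ℝ := fun σ u ↦ ‖C (σ • (‖u‖⁻¹ • u))‖ - σ with hd
  set w : ℝ → V → V := fun σ u ↦
    ‖C (σ • (‖u‖⁻¹ • u))‖⁻¹ • C (σ • (‖u‖⁻¹ • u)) - ‖u‖⁻¹ • u with hw
  have hRf : ∀ ρ u, R ρ u = ρ + χ ρ * d (cl ρ) u := fun ρ u ↦ hR ρ u
  have hΘf : ∀ ρ u, Θ ρ u = ‖‖u‖⁻¹ • u + χ ρ • w (cl ρ) u‖⁻¹ • (‖u‖⁻¹ • u + χ ρ • w (cl ρ) u) :=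
    fun ρ u ↦ hΘ ρ u
  -- the clamp value stays within `ε₁` of `1`
  have hcl1 : ∀ ρ, ρ ≤ 1 + ε₁ → |cl ρ - 1| ≤ ε₁ := by
    intro ρ hρ
    have h1 : 1 - ε₁ ≤ cl ρ := le_clamp hε₁ ρ
    have h2 : cl ρ ≤ max ρ (1 - ε₁) := by
      rcases le_or_gt (1 - ε₁) ρ with h | h
      · exact (clamp_le_self hε₁ h).trans (le_max_left _ _)
      · rw [show cl ρ = 1 - ε₁ from clamp_of_le hε₁ h.le]; exact le_max_right _ _
    rw [abs_le]; constructor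
    · linarith
    · have : max ρ (1 - ε₁) ≤ 1 + ε₁ := max_le hρ (by linarith); linarith
  have hclI : ∀ ρ, ρ ≤ 1 + ε₁ → cl ρ ∈ Icc (1 - ε' / 2) (1 + ε' / 2) := by
    intro ρ hρ
    have h := abs_le.1 (hcl1 ρ hρ)
    exact ⟨by linarith, by linarith⟩
  -- unit vectors
  have hunit : ∀ u ∈ Metric.sphere (0 : V) 1, ‖u‖ = 1 := fun u hu ↦ by simpa using hu
  have hNu : ∀ u : V, ‖u‖ = 1 → ‖u‖⁻¹ • u = u := fun u hu ↦ by rw [hu, inv_one, one_smul]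
  -- `χ ∈ [0, 1]`, `χ` is `Cχ`-Lipschitz
  have hχ01 : ∀ ρ, 0 ≤ χ ρ ∧ χ ρ ≤ 1 := fun ρ ↦ ⟨smoothTransition.nonneg _, smoothTransition.le_one _⟩
  have hχlip : ∀ ρ ρ', |χ ρ' - χ ρ| ≤ Cχ * |ρ' - ρ| :=
    abs_sub_le_of_abs_deriv_le ((contDiff_chi (n := 1)).differentiable one_ne_zero) hCχ
  -- the clamp is `Ch`-Lipschitz
  have hcllip : ∀ ρ ρ', |cl ρ' - cl ρ| ≤ Ch * |ρ' - ρ| := by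
    refine abs_sub_le_of_abs_deriv_le ((contDiff_clamp (n := 1)).differentiable one_ne_zero) ?_
    intro x
    rw [(hasDerivAt_clamp hε₁ x).deriv]
    exact hCh _
  /- ── the estimates at `σ = cl ρ` for unit vectors ── -/
  have hdκ : ∀ ρ, ρ ≤ 1 + ε₁ → ∀ u : V, ‖u‖ = 1 → |d (cl ρ) u| < κ := fun ρ hρ u hu ↦
    ((hest (cl ρ) ((hcl1 ρ hρ).trans hε₁e₁)).1 u hu).1
  have hwκ : ∀ ρ, ρ ≤ 1 + ε₁ → ∀ u : V, ‖u‖ = 1 → ‖w (cl ρ) u‖ < κ := fun ρ hρ u hu ↦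
    ((hest (cl ρ) ((hcl1 ρ hρ).trans hε₁e₁)).1 u hu).2
  have hdlip : ∀ ρ, ρ ≤ 1 + ε₁ → ∀ u u' : V, ‖u‖ = 1 → ‖u'‖ = 1 → ‖u - u'‖ < 1 →
      |d (cl ρ) u' - d (cl ρ) u| ≤ κ * ‖u' - u‖ := fun ρ hρ u u' hu hu' huu' ↦
    ((hest (cl ρ) ((hcl1 ρ hρ).trans hε₁e₁)).2 u u' hu hu' huu').1
  have hwlip : ∀ ρ, ρ ≤ 1 + ε₁ → ∀ u u' : V, ‖u‖ = 1 → ‖u'‖ = 1 → ‖u - u'‖ < 1 →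
      ‖w (cl ρ) u' - w (cl ρ) u‖ ≤ κ * ‖u' - u‖ := fun ρ hρ u u' hu hu' huu' ↦
    ((hest (cl ρ) ((hcl1 ρ hρ).trans hε₁e₁)).2 u u' hu hu' huu').2
  -- `w(cl ρ', u) - w(cl ρ, u)` is `Lw Ch`-Lipschitz in `ρ`
  have hwρ : ∀ ρ, ρ ≤ 1 + ε₁ → ∀ ρ', ρ' ≤ 1 + ε₁ → ∀ u : V, ‖u‖ = 1 →
      ‖w (cl ρ') u - w (cl ρ) u‖ ≤ Lw * Ch * |ρ' - ρ| := by
    intro ρ hρ ρ' hρ' u hu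
    have h := hLw (cl ρ) (hclI ρ hρ) (cl ρ') (hclI ρ' hρ') u hu
    calc ‖w (cl ρ') u - w (cl ρ) u‖ ≤ Lw * |cl ρ' - cl ρ| := h
      _ ≤ Lw * (Ch * |ρ' - ρ|) := mul_le_mul_of_nonneg_left (hcllip ρ ρ') hLw0
      _ = Lw * Ch * |ρ' - ρ| := by ring
  /- ── the six hypotheses of the shell lemma on `J × S` ── -/
  set J : Set ℝ := Ioc (0 : ℝ) (1 + ε₁) with hJ
  set S : Set V := Metric.sphere (0 : V) 1 with hS
  -- `Θ ρ u = N(u + χ ρ • w(cl ρ, u))` for unit `u`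
  have hΘu : ∀ ρ, ∀ u : V, ‖u‖ = 1 →
      Θ ρ u = ‖u + χ ρ • w (cl ρ) u‖⁻¹ • (u + χ ρ • w (cl ρ) u) := by
    intro ρ u hu; rw [hΘf, hNu u hu]
  have hΘnorm : ∀ ρ ∈ J, ∀ u ∈ S, ‖Θ ρ u‖ = 1 := by
    intro ρ hρ u hu
    have hu1 := hunit u hu
    obtain ⟨hl, -⟩ := norm_perturb_bounds hu1 (hχ01 ρ).1 (hχ01 ρ).2 (hwκ ρ hρ.2 u hu1).le
    have hP0 : u + χ ρ • w (cl ρ) u ≠ 0 := by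
      intro h; rw [h, norm_zero] at hl; linarith
    rw [hΘu ρ u hu1, norm_smul, norm_inv, norm_norm, inv_mul_cancel₀ (norm_ne_zero_iff.2 hP0)]
  have hRlow : ∀ ρ ∈ J, ∀ u ∈ S, min ρ (1 / 4) ≤ R ρ u := by
    intro ρ hρ u hu
    have hu1 := hunit u hu
    rw [hRf]
    rcases le_or_gt ρ (1 / 3) with h | h
    · rw [show χ ρ = 0 from chi_eq_zero h, zero_mul, add_zero]; exact min_le_left _ _
    · have h1 := abs_lt.1 (hdκ ρ hρ.2 u hu1)
      have h2 : -κ ≤ χ ρ * d (cl ρ) u := by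
        have := (hχ01 ρ)
        nlinarith [h1.1, h1.2, this.1, this.2]
      have : (1 : ℝ) / 4 ≤ ρ + χ ρ * d (cl ρ) u := by linarith
      exact (min_le_right _ _).trans this
  have hRpos : ∀ ρ ∈ J, ∀ u ∈ S, 0 < R ρ u := fun ρ hρ u hu ↦
    lt_of_lt_of_le (lt_min hρ.1 (by norm_num)) (hRlow ρ hρ u hu)
  have hΘnear : ∀ ρ ∈ J, ∀ u ∈ S, ‖Θ ρ u - u‖ ≤ 1 / 4 := by
    intro ρ hρ u hu
    have hu1 := hunit u hu
    rw [hΘu ρ u hu1]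
    have h := norm_normalize_perturb_sub_self_le hu1 (hχ01 ρ).1 (hχ01 ρ).2 (by linarith : κ < 1)
      (hwκ ρ hρ.2 u hu1).le
    linarith
  have hΘinj : ∀ ρ ∈ J, ∀ u ∈ S, ∀ u' ∈ S, ‖u - u'‖ < 1 →
      1 / 2 * ‖u - u'‖ ≤ ‖Θ ρ u - Θ ρ u'‖ := by
    intro ρ hρ u hu u' hu' huu'
    have hu1 := hunit u hu
    have hu1' := hunit u' hu'
    rw [hΘu ρ u hu1, hΘu ρ u' hu1']
    have h := norm_normalize_perturb_sub_ge (u := u) (u' := u') (c := χ ρ) hu1 hu1' (hχ01 ρ).1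
      (hχ01 ρ).2 hκ.le (by linarith) (hwκ ρ hρ.2 u hu1).le (hwκ ρ hρ.2 u' hu1').le
      (hwlip ρ hρ.2 u u' hu1 hu1' huu')
    rw [norm_sub_rev u u', norm_sub_rev (‖u + χ ρ • w (cl ρ) u‖⁻¹ • (u + χ ρ • w (cl ρ) u))]
    exact h
  have hΘρ : ∀ ρ ∈ J, ∀ ρ' ∈ J, ∀ u ∈ S, ‖Θ ρ u - Θ ρ' u‖ ≤ A * |ρ - ρ'| := by
    intro ρ hρ ρ' hρ' u hu
    have hu1 := hunit u hu
    rw [hΘu ρ u hu1, hΘu ρ' u hu1, norm_sub_rev, abs_sub_comm]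
    have h := norm_normalize_perturb_sub_perturb_le (a := u) (f := w (cl ρ) u) (f' := w (cl ρ') u)
      (c := χ ρ) (c' := χ ρ') (κ := κ) (Cc := Cχ) (L := Lw * Ch) (ρ := ρ) (ρ' := ρ') hu1
      (hχ01 ρ).1 (hχ01 ρ).2 (hχ01 ρ').1 (hχ01 ρ').2 (by linarith) (hwκ ρ hρ.2 u hu1).le
      (hwκ ρ' hρ'.2 u hu1).le (hχlip ρ ρ') (hwρ ρ hρ.2 ρ' hρ'.2 u hu1)
    rw [hAdef]
    exact h
  have hRR : ∀ ρ ∈ J, ∀ ρ' ∈ J, ρ ≤ ρ' → ∀ u ∈ S, ∀ u' ∈ S, ‖u - u'‖ < 1 →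
      1 / 2 * (ρ' - ρ) - κ * ‖u - u'‖ ≤ R ρ' u' - R ρ u := by
    intro ρ hρ ρ' hρ' hle u hu u' hu' huu'
    have hu1 := hunit u hu
    have hu1' := hunit u' hu'
    have hu0 : u ≠ 0 := by intro h; rw [h, norm_zero] at hu1; exact zero_ne_one hu1
    -- the `u`-part
    have h1 : R ρ' u' - R ρ' u ≥ -(κ * ‖u - u'‖) := by
      rw [hRf, hRf]
      have h2 := hdlip ρ' hρ'.2 u u' hu1 hu1' huu'
      have h3 : |χ ρ' * (d (cl ρ') u' - d (cl ρ') u)| ≤ κ * ‖u - u'‖ := by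
        rw [abs_mul, abs_of_nonneg (hχ01 ρ').1, norm_sub_rev]
        calc χ ρ' * |d (cl ρ') u' - d (cl ρ') u| ≤ 1 * (κ * ‖u' - u‖) :=
              mul_le_mul (hχ01 ρ').2 h2 (abs_nonneg _) zero_le_one
          _ = κ * ‖u' - u‖ := one_mul _
      have h4 := (abs_le.1 h3).1
      nlinarith
    -- the `ρ`-part
    have h5 : (1 - κ * (Cχ + Ch)) * (ρ' - ρ) ≤ R ρ' u - R ρ u := by
      have hdd : ∀ σ : ℝ, |σ - 1| ≤ ε₁ → |‖C (σ • (‖u‖⁻¹ • u))‖ - σ| ≤ κ := fun σ hσ ↦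
        (((hest σ (hσ.trans hε₁e₁)).1 u hu1).1).le
      have hgg : ∀ σ : ℝ, |σ - 1| ≤ ε₁ →
          1 - κ ≤ ⟪‖C (σ • (‖u‖⁻¹ • u))‖⁻¹ • C (σ • (‖u‖⁻¹ • u)),
            fderiv ℝ C (σ • (‖u‖⁻¹ • u)) (‖u‖⁻¹ • u)⟫ := fun σ hσ ↦
        hder σ (hσ.trans hε₁e₂) u hu1
      have h := mul_sub_le_unwindingRadius_sub hε₁ hε₁ε' hε'1' (hC.differentiableOn one_ne_zero) hC0 hu0
        hκ.le hCχ hCh hdd hgg hρ.1.le hle hρ'.2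
      rw [hR ρ' u, hR ρ u]
      exact h
    have h6 : 1 / 2 * (ρ' - ρ) ≤ (1 - κ * (Cχ + Ch)) * (ρ' - ρ) :=
      mul_le_mul_of_nonneg_right (by linarith) (sub_nonneg.2 hle)
    linarith
  /- ── conclusions ── -/
  refine ⟨?_, ?_, fun ρ hρ u hu ↦ ⟨hRpos ρ hρ u hu, hΘnorm ρ hρ u hu⟩, fun ρ hρ ρ' hρ' hle u hu ↦ ?_⟩
  rotate_left 2
  · have h := hRR ρ hρ ρ' hρ' hle u hu u hu (by rw [sub_self, norm_zero]; norm_num)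
    rw [sub_self, norm_zero, mul_zero, sub_zero] at h
    exact h
  · exact injOn_polarGraph_local (m := 1 / 2) (A := A) (μ := 1 / 2) (B := κ) (by norm_num) hκ.le
      hAB hΘnorm hRpos hΘnear hΘinj hΘρ hRR
  · intro t ht
    -- on `[t, 1 + ε₁]`, `R ≥ R₀ = min t (1/4)`
    set R₀ : ℝ := min t (1 / 4) with hR₀
    have hR₀pos : 0 < R₀ := lt_min ht (by norm_num)
    set Jt : Set ℝ := Icc t (1 + ε₁) with hJt
    have hJtJ : Jt ⊆ J := fun ρ hρ ↦ ⟨ht.trans_le hρ.1, hρ.2⟩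
    have hRge : ∀ ρ ∈ Jt, ∀ u ∈ S, R₀ ≤ R ρ u := fun ρ hρ u hu ↦
      (min_le_min hρ.1 le_rfl).trans (hRlow ρ (hJtJ hρ) u hu)
    set K₁ : ℝ := (1 / 2 * R₀ + 2 * κ) / (R₀ * (1 / 2 * (1 / 2) - A * κ)) with hK₁
    set K₂ : ℝ := (2 / R₀ + A * K₁) / (1 / 2) with hK₂
    have hgap : 0 < 1 / 2 * (1 / 2) - A * κ := by linarith
    have hK₁0 : 0 ≤ K₁ := by rw [hK₁]; positivity
    have hK₂0 : 0 ≤ K₂ := by rw [hK₂]; positivity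
    refine ⟨K₁ + K₂, by positivity, ?_⟩
    intro ρ hρ ρ' hρ' u hu u' hu' huu'
    have key : ∀ (a b : ℝ) (x y : V), a ∈ Jt → b ∈ Jt → a ≤ b → x ∈ S → y ∈ S → ‖x - y‖ < 1 →
        b - a ≤ K₁ * ‖R b y • Θ b y - R a x • Θ a x‖ ∧
          ‖x - y‖ ≤ K₂ * ‖R b y • Θ b y - R a x • Θ a x‖ := by
      intro a b x y ha hb hab hx hy hxy
      exact polarGraph_sub_le (m := 1 / 2) (A := A) (μ := 1 / 2) (B := κ) (R₀ := R₀) (by norm_num)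
        hA0 hκ.le hAB hR₀pos
        (fun r hr v hv ↦ hΘnorm r (hJtJ hr) v hv) hRge
        (fun r hr v hv v' hv' h ↦ hΘinj r (hJtJ hr) v hv v' hv' h)
        (fun r hr r' hr' v hv ↦ hΘρ r (hJtJ hr) r' (hJtJ hr') v hv)
        (fun r hr r' hr' h v hv v' hv' h' ↦ hRR r (hJtJ hr) r' (hJtJ hr') h v hv v' hv' h')
        ha hb hab hx hy hxy
    rcases le_total ρ ρ' with hle | hle
    · obtain ⟨h1, h2⟩ := key ρ ρ' u u' hρ hρ' hle hu hu' huu'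
      rw [abs_of_nonneg (sub_nonneg.2 hle)]
      have := add_le_add h1 h2
      linarith [mul_nonneg hK₁0 (norm_nonneg (R ρ' u' • Θ ρ' u' - R ρ u • Θ ρ u)),
        mul_nonneg hK₂0 (norm_nonneg (R ρ' u' • Θ ρ' u' - R ρ u • Θ ρ u))]
    · have huu'' : ‖u' - u‖ < 1 := by rwa [norm_sub_rev]
      obtain ⟨h1, h2⟩ := key ρ' ρ u' u hρ' hρ hle hu' hu huu''
      rw [abs_of_nonpos (sub_nonpos.2 hle), norm_sub_rev u u',
        norm_sub_rev (R ρ' u' • Θ ρ' u') (R ρ u • Θ ρ u)]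
      have := add_le_add h1 h2
      linarith [mul_nonneg hK₁0 (norm_nonneg (R ρ u • Θ ρ u - R ρ' u' • Θ ρ' u')),
        mul_nonneg hK₂0 (norm_nonneg (R ρ u • Θ ρ u - R ρ' u' • Θ ρ' u'))]

set_option maxHeartbeats 400000 in
/-- **The shell package.** See the module docstring. [cite: Weinstein1968, proof of the main
theorem, step (3)] -/
theorem unwinding_shell {C : V → V} {ε' : ℝ} (hε' : 0 < ε') (hε'1 : ε' ≤ 1 / 2)
    (hC : ContDiffOn ℝ 1 C {v : V | 1 - ε' < ‖v‖ ∧ ‖v‖ < 1 + ε'})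
    (hC0 : ∀ v : V, 1 - ε' < ‖v‖ → ‖v‖ < 1 + ε' → C v ≠ 0)
    (hCid : ∀ u : V, ‖u‖ = 1 → C u = u) (hCtr : ∀ u : V, ‖u‖ = 1 → 1 ≤ ⟪u, fderiv ℝ C u u⟫) :
    ∃ ε₁ : ℝ, 0 < ε₁ ∧ ε₁ ≤ ε' / 2 ∧ ε₁ ≤ 1 / 4 ∧
      ∀ (R : ℝ → V → ℝ) (Θ : ℝ → V → V),
        (∀ ρ u, R ρ u = ρ + smoothTransition (3 * ρ - 1) *
          (‖C (((1 - ε₁) + ε₁ / 2 * ((ρ - (1 - ε₁)) / (ε₁ / 2) *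
              smoothTransition ((ρ - (1 - ε₁)) / (ε₁ / 2)))) • (‖u‖⁻¹ • u))‖ -
            ((1 - ε₁) + ε₁ / 2 * ((ρ - (1 - ε₁)) / (ε₁ / 2) *
              smoothTransition ((ρ - (1 - ε₁)) / (ε₁ / 2)))))) →
        (∀ ρ u, Θ ρ u = ‖‖u‖⁻¹ • u + smoothTransition (3 * ρ - 1) •
            (‖C (((1 - ε₁) + ε₁ / 2 * ((ρ - (1 - ε₁)) / (ε₁ / 2) *
                smoothTransition ((ρ - (1 - ε₁)) / (ε₁ / 2)))) • (‖u‖⁻¹ • u))‖⁻¹ •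
              C (((1 - ε₁) + ε₁ / 2 * ((ρ - (1 - ε₁)) / (ε₁ / 2) *
                smoothTransition ((ρ - (1 - ε₁)) / (ε₁ / 2)))) • (‖u‖⁻¹ • u)) - ‖u‖⁻¹ • u)‖⁻¹ •
          (‖u‖⁻¹ • u + smoothTransition (3 * ρ - 1) •
            (‖C (((1 - ε₁) + ε₁ / 2 * ((ρ - (1 - ε₁)) / (ε₁ / 2) *
                smoothTransition ((ρ - (1 - ε₁)) / (ε₁ / 2)))) • (‖u‖⁻¹ • u))‖⁻¹ •
              C (((1 - ε₁) + ε₁ / 2 * ((ρ - (1 - ε₁)) / (ε₁ / 2) *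
                smoothTransition ((ρ - (1 - ε₁)) / (ε₁ / 2)))) • (‖u‖⁻¹ • u)) - ‖u‖⁻¹ • u))) →
        InjOn (fun q : ℝ × V ↦ R q.1 q.2 • Θ q.1 q.2) (Ioc 0 (1 + ε₁) ×ˢ Metric.sphere (0 : V) 1) ∧
        (∀ t : ℝ, 0 < t → ∃ K : ℝ, 0 ≤ K ∧ ∀ ρ ∈ Icc t (1 + ε₁), ∀ ρ' ∈ Icc t (1 + ε₁),
          ∀ u ∈ Metric.sphere (0 : V) 1, ∀ u' ∈ Metric.sphere (0 : V) 1, ‖u - u'‖ < 1 →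
            |ρ' - ρ| + ‖u - u'‖ ≤ K * ‖R ρ' u' • Θ ρ' u' - R ρ u • Θ ρ u‖) ∧
        (∀ ρ ∈ Ioc (0 : ℝ) (1 + ε₁), ∀ u ∈ Metric.sphere (0 : V) 1, 0 < R ρ u ∧ ‖Θ ρ u‖ = 1) := by
  obtain ⟨ε₁, h1, h2, h3, h⟩ := unwinding_shell₂ hε' hε'1 hC hC0 hCid hCtr
  refine ⟨ε₁, h1, h2, h3, fun R Θ hR hΘ ↦ ?_⟩
  obtain ⟨a, b, c, -⟩ := h R Θ hR hΘ
  exact ⟨a, b, c⟩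

end Literature.Geometry.Riemannian

end
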